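import Literature.Probability.LatticeModels.CriticalEtaUpperDCPProofs
import HarnessLib

/-!
# Route `CoerciveSharpness`, crux `WindowOfGrowth` (item stmt-CriticalPhenomena-18198), line `eta_deficit`:
# registered stub `stub_denominator_le`

The denominator of Duminil-Copin–Panis (1.9) (arXiv:2404.05700, proof of Theorem 1.5, p. 6) at `d = 3`
under a power upper bound `F ≤ K‖x‖^{-(1+b)}`, for the FULL range `0 ≤ b ≤ 3/4`:
`Σ_{x ∈ Λ_{4n}} F x + n Σ_{k=1}^{2n} k F(k e₁) ≤ (1 + 872K) n^{2-b}` (`n ≥ 1`). This is the tree's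
`Literature.Probability.LatticeModels.dcp_denominator_le` (`CriticalEtaUpperDCPProofs.lean`) with its
hypothesis `1/2 < b` weakened to `0 ≤ b` (the proof only uses `0 ≤ b ≤ 3/4`: shell estimate
`sum_box_erase_norm_rpow_le`, `sum_Icc_rpow_sub_one_le` with `p = 1 - b ∈ [1/4, 1]`, `4^{1-b} ≤ 4`);
the boundary value `b = 1/2` is exactly the load-bearing case of the crux. Helper file (`--supports`);
the composition lives in `Theorems/CoerciveSharpnessWindowOfGrowth.lean`. No definition, no notation.
-/

noncomputable section

namespace Summit.CriticalPhenomena.Ising3DConformalLimit.Theorems.CoerciveSharpnessWindowOfGrowth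

open scoped BigOperators
open Finset
open Literature.Probability.LatticeModels

/-- **Registered stub `stub_denominator_le` of line `eta_deficit`, proved**: the denominator of
Duminil-Copin–Panis (1.9) at `d = 3` under a power upper bound `F ≤ K‖x‖^{-(1+b)}`, full range
`0 ≤ b ≤ 3/4` (the tree's `dcp_denominator_le` with `1/2 < b` weakened to `0 ≤ b`; same proof). [cite: DuminilCopinPanis2025LowerBounds, proof of Theorem 1.5 (arXiv p. 6)] -/
theorem stub_denominator_le :
    ∀ (F : Site 3 → ℝ) (K b : ℝ), 0 < K → 0 ≤ b → b ≤ 3 / 4 → F 0 = 1 →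
      (∀ x : Site 3, x ≠ 0 → F x ≤ K * ‖x‖ ^ (-(1 + b))) →
      ∀ n : ℕ, 1 ≤ n →
        (∑ x ∈ box 3 (4 * n), F x) +
            (n : ℝ) * ∑ k ∈ Finset.Icc 1 (2 * n), (k : ℝ) * F (Pi.single 0 (k : ℤ)) ≤
          (1 + 872 * K) * (n : ℝ) ^ (2 - b) := by
  intro F K b hK hb0 hb_hi hF0 hFle n hn
  have ht : (1 : ℝ) ≤ n := by exact_mod_cast hn
  have htpos : (0 : ℝ) < n := by linarith
  have hsplit : (n : ℝ) ^ (2 - b) = n * (n : ℝ) ^ (1 - b) := by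
    rw [show (2 : ℝ) - b = 1 + (1 - b) by ring, Real.rpow_add htpos, Real.rpow_one]
  -- (1) the box sum `χ_{4n}`
  have h1 : ∑ x ∈ box 3 (4 * n), F x ≤ 1 + 864 * K * (n : ℝ) ^ (2 - b) := by
    rw [← Finset.add_sum_erase _ _ (zero_mem_box 3 (4 * n)), hF0]
    have hA : ∑ x ∈ (box 3 (4 * n)).erase 0, F x ≤
        K * ∑ x ∈ (box 3 (4 * n)).erase 0, ‖x‖ ^ (-(1 + b)) := by
      rw [Finset.mul_sum]
      exact Finset.sum_le_sum fun x hx => hFle x (Finset.ne_of_mem_erase hx)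
    have hB := sum_box_erase_norm_rpow_le (1 + b) (4 * n)
    have hC : ∑ m ∈ Finset.range (4 * n), ((m : ℝ) + 1) ^ (2 - (1 + b)) ≤
        (4 * n : ℕ) * ((4 * n : ℕ) : ℝ) ^ (1 - b) := by
      have hle : ∀ m ∈ Finset.range (4 * n),
          ((m : ℝ) + 1) ^ (2 - (1 + b)) ≤ ((4 * n : ℕ) : ℝ) ^ (1 - b) := by
        intro m hm
        rw [show (2 : ℝ) - (1 + b) = 1 - b by ring]
        have hm' : m + 1 ≤ 4 * n := Finset.mem_range.1 hm
        have hm'' : (m : ℝ) + 1 ≤ ((4 * n : ℕ) : ℝ) := by exact_mod_cast hm'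
        exact Real.rpow_le_rpow (by positivity) hm'' (by linarith)
      calc ∑ m ∈ Finset.range (4 * n), ((m : ℝ) + 1) ^ (2 - (1 + b))
          ≤ ∑ _m ∈ Finset.range (4 * n), ((4 * n : ℕ) : ℝ) ^ (1 - b) := Finset.sum_le_sum hle
        _ = (4 * n : ℕ) * ((4 * n : ℕ) : ℝ) ^ (1 - b) := by
            rw [Finset.sum_const, Finset.card_range, nsmul_eq_mul]
    have hD : ((4 * n : ℕ) : ℝ) * ((4 * n : ℕ) : ℝ) ^ (1 - b) ≤ 16 * (n : ℝ) ^ (2 - b) := by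
      push_cast
      rw [Real.mul_rpow (by norm_num) htpos.le, hsplit]
      have h4 : (4 : ℝ) ^ (1 - b) ≤ 4 := by
        calc (4 : ℝ) ^ (1 - b) ≤ (4 : ℝ) ^ (1 : ℝ) :=
              Real.rpow_le_rpow_of_exponent_le (by norm_num) (by linarith)
          _ = 4 := Real.rpow_one 4
      have hpos : 0 ≤ (n : ℝ) * (n : ℝ) ^ (1 - b) :=
        mul_nonneg htpos.le (Real.rpow_nonneg htpos.le _)
      calc 4 * (n : ℝ) * ((4 : ℝ) ^ (1 - b) * (n : ℝ) ^ (1 - b))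
          = 4 * (4 : ℝ) ^ (1 - b) * ((n : ℝ) * (n : ℝ) ^ (1 - b)) := by ring
        _ ≤ 4 * 4 * ((n : ℝ) * (n : ℝ) ^ (1 - b)) := by gcongr
        _ = 16 * ((n : ℝ) * (n : ℝ) ^ (1 - b)) := by norm_num
    have hE : ∑ x ∈ (box 3 (4 * n)).erase 0, F x ≤ 864 * K * (n : ℝ) ^ (2 - b) := by
      calc ∑ x ∈ (box 3 (4 * n)).erase 0, F x
          ≤ K * ∑ x ∈ (box 3 (4 * n)).erase 0, ‖x‖ ^ (-(1 + b)) := hA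
        _ ≤ K * (54 * ∑ m ∈ Finset.range (4 * n), ((m : ℝ) + 1) ^ (2 - (1 + b))) :=
            mul_le_mul_of_nonneg_left hB hK.le
        _ ≤ K * (54 * ((4 * n : ℕ) * ((4 * n : ℕ) : ℝ) ^ (1 - b))) := by gcongr
        _ ≤ K * (54 * (16 * (n : ℝ) ^ (2 - b))) := by gcongr
        _ = 864 * K * (n : ℝ) ^ (2 - b) := by ring
    linarith
  -- (2) the axis sum
  have h2 : ∑ k ∈ Finset.Icc 1 (2 * n), (k : ℝ) * F (Pi.single 0 (k : ℤ)) ≤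
      8 * K * (n : ℝ) ^ (1 - b) := by
    have hterm : ∀ k ∈ Finset.Icc 1 (2 * n),
        (k : ℝ) * F (Pi.single 0 (k : ℤ)) ≤ K * (k : ℝ) ^ ((1 - b) - 1) := by
      intro k hk
      have hk1 : 1 ≤ k := (Finset.mem_Icc.1 hk).1
      have hkpos : (0 : ℝ) < k := by exact_mod_cast hk1
      have hne : (Pi.single 0 (k : ℤ) : Site 3) ≠ 0 := by
        intro h
        have h0 := congr_fun h 0
        simp at h0
        omega
      have hnorm : ‖(Pi.single 0 (k : ℤ) : Site 3)‖ = k := by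
        rw [Pi.norm_single, Int.norm_natCast]
      have hFk := hFle _ hne
      rw [hnorm] at hFk
      calc (k : ℝ) * F (Pi.single 0 (k : ℤ)) ≤ (k : ℝ) * (K * (k : ℝ) ^ (-(1 + b))) :=
            mul_le_mul_of_nonneg_left hFk hkpos.le
        _ = K * ((k : ℝ) ^ (1 : ℝ) * (k : ℝ) ^ (-(1 + b))) := by
            rw [Real.rpow_one]
            ring
        _ = K * (k : ℝ) ^ ((1 - b) - 1) := by
            rw [← Real.rpow_add hkpos, show (1 : ℝ) + -(1 + b) = (1 - b) - 1 by ring]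
    have hx : ((2 * n : ℕ) : ℝ) ^ (1 - b) ≤ 2 * (n : ℝ) ^ (1 - b) := by
      push_cast
      rw [Real.mul_rpow (by norm_num) htpos.le]
      have h2' : (2 : ℝ) ^ (1 - b) ≤ 2 := by
        calc (2 : ℝ) ^ (1 - b) ≤ (2 : ℝ) ^ (1 : ℝ) :=
              Real.rpow_le_rpow_of_exponent_le (by norm_num) (by linarith)
          _ = 2 := Real.rpow_one 2
      exact mul_le_mul_of_nonneg_right h2' (Real.rpow_nonneg htpos.le _)
    have hnn : 0 ≤ 2 * (n : ℝ) ^ (1 - b) := by positivity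
    calc ∑ k ∈ Finset.Icc 1 (2 * n), (k : ℝ) * F (Pi.single 0 (k : ℤ))
        ≤ ∑ k ∈ Finset.Icc 1 (2 * n), K * (k : ℝ) ^ ((1 - b) - 1) := Finset.sum_le_sum hterm
      _ = K * ∑ k ∈ Finset.Icc 1 (2 * n), (k : ℝ) ^ ((1 - b) - 1) := by rw [Finset.mul_sum]
      _ ≤ K * (((2 * n : ℕ) : ℝ) ^ (1 - b) / (1 - b)) :=
          mul_le_mul_of_nonneg_left (sum_Icc_rpow_sub_one_le (by linarith) (by linarith) _) hK.le
      _ ≤ K * (2 * (n : ℝ) ^ (1 - b) / (1 - b)) :=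
          mul_le_mul_of_nonneg_left (div_le_div_of_nonneg_right hx (by linarith)) hK.le
      _ ≤ K * (2 * (n : ℝ) ^ (1 - b) / (1 / 4)) :=
          mul_le_mul_of_nonneg_left (div_le_div_of_nonneg_left hnn (by norm_num) (by linarith))
            hK.le
      _ = 8 * K * (n : ℝ) ^ (1 - b) := by ring
  -- (3) combine
  have hone : 1 ≤ (n : ℝ) ^ (2 - b) := Real.one_le_rpow ht (by linarith)
  calc (∑ x ∈ box 3 (4 * n), F x) +
        (n : ℝ) * ∑ k ∈ Finset.Icc 1 (2 * n), (k : ℝ) * F (Pi.single 0 (k : ℤ))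
      ≤ (1 + 864 * K * (n : ℝ) ^ (2 - b)) + (n : ℝ) * (8 * K * (n : ℝ) ^ (1 - b)) :=
        add_le_add h1 (mul_le_mul_of_nonneg_left h2 htpos.le)
    _ = 1 + 872 * K * (n : ℝ) ^ (2 - b) := by
        rw [hsplit]
        ring
    _ ≤ (1 + 872 * K) * (n : ℝ) ^ (2 - b) := by nlinarith

end Summit.CriticalPhenomena.Ising3DConformalLimit.Theorems.CoerciveSharpnessWindowOfGrowth
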